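import Summits.AtomisticToContinuum.Crystallization.Theorems.BraggSlacknessRigidityStrictCertificateBragg

/-!
# Crux `ExactCertificate` (stmt-AtomisticToContinuum-11959), line `closure-makes-nogap-exact`,
# skeleton VIII (`InvisibilityDichotomy`): stub `stub_braggOfInvisible`

Support file for the crux `ThreeConeCertificate.ExactCertificate`, skeleton VIII
(`Cruxes.ExactCertificate.Invisibility`), which proves that no nonzero finite-range continuous
radial kernel `α` is INVISIBLE to a Bravais crystal `P ⊂ ℝ³` (field `Σ_{y ∈ P} α(dist w y) ≡ 0`).
This file is the bridge from invisibility to the Fourier side: for a finite-range radial kernel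
`α` (vanishing on `[L, ∞)`) with integrable `A := α ∘ ‖·‖` whose field on a periodic configuration
`P` vanishes identically, the motif structure factor times the Fourier transform vanishes at
every dual-lattice vector `k`:

  `stub_braggOfInvisible :  S_P(k) · 𝓕A(k) = 0`,   `S_P(k) = Σ_{x ∈ motif} e^{−2πi⟨x,k⟩}`,
  for all `k` with `⟨k, g⟩ ∈ ℤ` (`g ∈ P.lattice`).

Proof (exactly the argument of `…StrictCertificateBragg.structureFactor_mul_fourier_eq_zero`, with
the witness hypotheses replaced by the direct invisibility hypothesis).  Since `α` has finite
range, every coset family `d ↦ α(dist v (latVec d))` has finite support (`Field.finite_near`),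
hence is summable; so the field is the finite sum of coset sums (`Field.field_hasSum`) and
invisibility reads `Σ_{x ∈ motif} Σ_d α(dist (w − x) (latVec d)) = 0`, i.e. (re-indexing by the
lattice, `tsum_lattice_sum_motif_eq_zero`) `Σ'_{ℓ ∈ G} Σ_{x ∈ motif} α‖ℓ + w − x‖ = 0` for every
`w`.  The twisted motif-summed translate `Φ(v) = e^{−2πi⟨v,k⟩} Σ_x A(v − x)` is integrable, its
lattice sums are `e^{−2πi⟨w,k⟩} · 0 = 0` (the character is `G`-periodic since `k` is dual), so
`∫ Φ = 0` (`integral_eq_zero_of_tsum_translate_eq_zero`, unfolding over a fundamental domain);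
and `∫ Φ = S_P(k) · 𝓕A(k)` by translating each motif term (`integral_add_right_eq_self`,
`Real.fourier_eq'`).  All `[folklore]`.
-/

noncomputable section

namespace Summit.AtomisticToContinuum.Crystallization.Theorems.ThreeConeCertificateExactCertificate.Invisibility

open Literature.MathematicalPhysics.StatisticalMechanics MeasureTheory
open Summit.AtomisticToContinuum.Crystallization.Theorems.ChargedEnergyGapNegative (E3)
open Summit.AtomisticToContinuum.Crystallization.Theorems.ChargedEnergyGapNegative.Blocks
  (zBasis latVec latVecL latVec_neg)
open Summit.AtomisticToContinuum.Crystallization.Theorems.ThreeConeCertificateExactCertificate.Field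
  (field_hasSum finite_near)
open Summit.AtomisticToContinuum.Crystallization.Theorems.BraggSlacknessRigidityStrictCertificate
  (integral_eq_zero_of_tsum_translate_eq_zero tsum_lattice_sum_motif_eq_zero)
open scoped BigOperators FourierTransform RealInnerProductSpace

/-- **BRAGG-PEAK VANISHING FOR AN INVISIBLE FINITE-RANGE KERNEL: `S_P(k) · 𝓕A(k) = 0` on the dual
lattice.**  For a periodic configuration `P ⊂ ℝ³`, a kernel `α` vanishing on `[L, ∞)` with
integrable `A = α ∘ ‖·‖` whose field `Σ_{y ∈ P} α(dist w y)` vanishes at every `w`, and every `k`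
with `⟨k, g⟩ ∈ ℤ` for all periods `g`: `(Σ_{x ∈ motif} e^{−2πi⟨x,k⟩}) · 𝓕A(k) = 0`.  Proof: the
coset families have finite support, so invisibility gives vanishing lattice sums of the twisted
motif-summed translate `Φ(v) = e^{−2πi⟨v,k⟩} Σ_x A(v − x)`, whence `∫ Φ = 0` by unfolding, while
`∫ Φ = S_P(k) · 𝓕A(k)` by translating each term. [folklore] -/
theorem stub_braggOfInvisible :
    ∀ (P : Literature.MathematicalPhysics.StatisticalMechanics.PeriodicConfiguration 3) (α : ℝ → ℝ) (L : ℝ),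
    (∀ r : ℝ, L ≤ r → α r = 0) →
    MeasureTheory.Integrable (fun v : EuclideanSpace ℝ (Fin 3) => (α ‖v‖ : ℂ)) →
    (∀ w : EuclideanSpace ℝ (Fin 3),
      HasSum (fun y : P.points => α (dist w (y : EuclideanSpace ℝ (Fin 3)))) 0) →
    ∀ k : EuclideanSpace ℝ (Fin 3), (∀ g ∈ P.lattice, ∃ n : ℤ, inner ℝ k g = (n : ℝ)) →
      (∑ x ∈ P.motif, Complex.exp (↑(-2 * Real.pi * inner ℝ x k) * Complex.I)) *
        𝓕 (fun v : EuclideanSpace ℝ (Fin 3) => (α ‖v‖ : ℂ)) k = 0 := by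
  -- adapted from BraggSlacknessRigidityStrictCertificateBragg.structureFactor_mul_fourier_eq_zero
  intro P α L hL hFi hinv k hk
  -- Step 1: every coset family has finite support, hence is summable
  have hs : ∀ v : E3, Summable fun d : Fin 3 → ℤ => α (dist v (latVec P d)) := by
    intro v
    refine summable_of_ne_finset_zero (s := (finite_near P v L).toFinset) fun d hd => ?_
    refine hL _ (le_of_not_gt fun hlt => hd ?_)
    exact (finite_near P v L).mem_toFinset.2 hlt
  -- Step 2: invisibility in coset form
  have hz : ∀ w : E3, ∑ x ∈ P.motif, ∑' d : Fin 3 → ℤ, α (dist (w - x) (latVec P d)) = 0 :=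
    fun w => (field_hasSum P α hs w).unique (hinv w)
  -- Step 3: invisibility re-indexed by the lattice
  have hT : ∀ w : E3, (∀ x : E3, Summable fun l : P.lattice => α ‖(l : E3) + w - x‖) ∧
      ∑' l : P.lattice, ∑ x ∈ P.motif, α ‖(l : E3) + w - x‖ = 0 := fun w =>
    tsum_lattice_sum_motif_eq_zero P (φ := fun v => α ‖v‖)
      (fun v => by simpa only [dist_eq_norm] using hs v)
      (fun w => by simpa only [dist_eq_norm] using hz w) w
  -- Step 4: twist and unfold
  set F : E3 → ℂ := fun v => (α ‖v‖ : ℂ) with hFdef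
  set χ : E3 → ℂ := fun v => Complex.exp (↑(-2 * Real.pi * ⟪v, k⟫) * Complex.I) with hχdef
  set Φ : E3 → ℂ := fun v => χ v * ∑ x ∈ P.motif, F (v - x) with hΦdef
  have hχ_norm : ∀ v, ‖χ v‖ = 1 := fun v => Complex.norm_exp_ofReal_mul_I _
  have hχ_cont : Continuous χ := by
    rw [hχdef]
    fun_prop
  have hχ_meas : AEStronglyMeasurable χ (volume : Measure E3) := hχ_cont.aestronglyMeasurable
  -- the character is periodic along the lattice (k is a dual vector)
  have hχ_per : ∀ (l : P.lattice) (w : E3), χ ((l : E3) + w) = χ w := by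
    intro l w
    obtain ⟨n, hn⟩ := hk l l.2
    show Complex.exp (↑(-2 * Real.pi * ⟪(l : E3) + w, k⟫) * Complex.I) =
      Complex.exp (↑(-2 * Real.pi * ⟪w, k⟫) * Complex.I)
    rw [inner_add_left, real_inner_comm k (l : E3), hn]
    rw [show ((-2 * Real.pi * ((n : ℝ) + ⟪w, k⟫) : ℝ) : ℂ) * Complex.I =
        ↑(-2 * Real.pi * ⟪w, k⟫) * Complex.I + ((-n : ℤ) : ℂ) * (2 * Real.pi * Complex.I) by
      push_cast; ring]
    rw [Complex.exp_add, Complex.exp_int_mul_two_pi_mul_I, mul_one]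
  -- translating the character
  have hχ_add : ∀ v x : E3, χ (v + x) = χ x * χ v := by
    intro v x
    show Complex.exp (↑(-2 * Real.pi * ⟪v + x, k⟫) * Complex.I) =
      Complex.exp (↑(-2 * Real.pi * ⟪x, k⟫) * Complex.I) *
        Complex.exp (↑(-2 * Real.pi * ⟪v, k⟫) * Complex.I)
    rw [inner_add_left, ← Complex.exp_add]
    congr 1
    push_cast
    ring
  -- integrability
  have hterm : ∀ x : E3, Integrable fun v => χ v * F (v - x) := fun x =>
    (hFi.comp_sub_right x).bdd_mul (c := 1) hχ_meas (ae_of_all _ fun v => (hχ_norm v).le)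
  have hΦi : Integrable Φ :=
    (integrable_finsetSum _ fun x _ => hFi.comp_sub_right x).bdd_mul (c := 1) hχ_meas
      (ae_of_all _ fun v => (hχ_norm v).le)
  -- the lattice sums of Φ vanish
  have hzero : ∀ w : E3, ∑' l : P.lattice, Φ ((l : E3) + w) = 0 := by
    intro w
    obtain ⟨-, hTw⟩ := hT w
    have hT' : ∑' l : P.lattice, ∑ x ∈ P.motif, F ((l : E3) + w - x) = 0 := by
      have h := congrArg (fun r : ℝ => (r : ℂ)) hTw
      simp only [Complex.ofReal_zero, Complex.ofReal_tsum, Complex.ofReal_sum] at h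
      exact h
    calc ∑' l : P.lattice, Φ ((l : E3) + w)
        = ∑' l : P.lattice, χ w * ∑ x ∈ P.motif, F ((l : E3) + w - x) :=
          tsum_congr fun l => by
            show χ ((l : E3) + w) * ∑ x ∈ P.motif, F ((l : E3) + w - x) = _
            rw [hχ_per]
      _ = χ w * ∑' l : P.lattice, ∑ x ∈ P.motif, F ((l : E3) + w - x) := tsum_mul_left
      _ = 0 := by rw [hT', mul_zero]
  -- ∫ Φ = S(k) · 𝓕F(k)
  have hone : ∀ x : E3, ∫ v, χ v * F (v - x) =
      Complex.exp (↑(-2 * Real.pi * ⟪x, k⟫) * Complex.I) * 𝓕 F k := by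
    intro x
    have hshift : ∫ v, χ v * F (v - x) = ∫ v, χ (v + x) * F v := by
      rw [← integral_add_right_eq_self (fun v => χ v * F (v - x)) x]
      simp only [add_sub_cancel_right]
    have hpt : ∀ v, χ (v + x) * F v = χ x * (χ v * F v) := fun v => by rw [hχ_add, mul_assoc]
    rw [hshift]
    simp_rw [hpt]
    rw [integral_const_mul, Real.fourier_eq']
    simp only [hχdef, smul_eq_mul]
  have hint : ∫ v, Φ v =
      (∑ x ∈ P.motif, Complex.exp (↑(-2 * Real.pi * ⟪x, k⟫) * Complex.I)) * 𝓕 F k := by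
    calc ∫ v, Φ v = ∫ v, ∑ x ∈ P.motif, χ v * F (v - x) := by
            refine integral_congr_ae (ae_of_all _ fun v => ?_)
            show χ v * ∑ x ∈ P.motif, F (v - x) = ∑ x ∈ P.motif, χ v * F (v - x)
            rw [Finset.mul_sum]
      _ = ∑ x ∈ P.motif, ∫ v, χ v * F (v - x) := integral_finsetSum _ fun x _ => hterm x
      _ = ∑ x ∈ P.motif, Complex.exp (↑(-2 * Real.pi * ⟪x, k⟫) * Complex.I) * 𝓕 F k :=
            Finset.sum_congr rfl fun x _ => hone x
      _ = (∑ x ∈ P.motif, Complex.exp (↑(-2 * Real.pi * ⟪x, k⟫) * Complex.I)) * 𝓕 F k := by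
            rw [Finset.sum_mul]
  rw [← hint]
  exact integral_eq_zero_of_tsum_translate_eq_zero P hΦi hzero

end Summit.AtomisticToContinuum.Crystallization.Theorems.ThreeConeCertificateExactCertificate.Invisibility

end
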